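import HarnessLib
import Literature.Probability.LatticeModels.PointwiseScalingLimitScaleCovariant

/-!
# Vague asymptotic isotropy of the critical `ℤ³` two-point function, XIII:
# the window `1/2 ≤ Δ ≤ 1` for a PAIR scaling limit
(route HarmonicMomentsIsotropy, support item stmt-CriticalPhenomena-6036 `TwoPointAsymptoticIsotropy`;
fourth file of the pair-only conditional line)

Pair-only form of the tree theorem `scalingDimension_mem_Icc_holds`
(`Literature/…/CriticalScalingDimension`): if the renormalised critical PAIR correlator of the
nearest-neighbour Ising model on `ℤ³` converges,
`TendstoLocallyUniformlyOn (rescaledCorrelator (criticalCorr 3) ρ 2) S₂ (𝓝[>] 0) (NonCoincident 3 2)`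
with `ρ > 0` on `(0,1]`, the kernel is positive at `(0, e₀)`, and the renormalisation is regularly
varying at the factor `1/2`, `ρ(δ/2)/ρ(δ) → 2^{Δ}` (automatic for a non-degenerate pair limit, file XII
`exists_rpow_scale_and_ratio₂`), then `1/2 ≤ Δ ≤ 1` (`pair_window₂`). Proof as in the tree: along the
dyadic meshes `δ_k = 2^{-(k+1)}` the increments `log ρ(δ_{k+1})² − log ρ(δ_k)²` tend to `2Δ log 2`, hence
(Cesàro) `log ρ(δ_k)²/k → 2Δ log 2`, while `ρ(δ_k)² ⟨σ₀σ_{2^{k+1}e₁}⟩_{β_c} → S₂(0,e₀) > 0` and the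
two-point bounds `c‖x‖⁻² ≤ ⟨σ₀σ_x⟩_{β_c} ≤ C‖x‖⁻¹` (`criticalTwoPoint_bounds_holds`) squeeze
`log 2 ≤ 2Δ log 2 ≤ 2 log 2`.

References: H. Duminil-Copin, *Lectures on the Ising and Potts models on the hypercubic lattice*
(2019), Thm. 4.8 [DuminilCopin2019]; B. Simon, Comm. Math. Phys. 77 (1980) 111 [Simon1980].
No definitions are introduced.
-/

noncomputable section

namespace Summit.CriticalPhenomena.Ising3DConformalLimit.HarmonicMomentsIsotropyTwoPoint

open Literature.Probability.LatticeModels Filter Set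
open scoped Topology

variable {ρ : ℝ → ℝ} {S2 : (Fin 2 → EuclideanSpace ℝ (Fin 3)) → ℝ}

/-- Pair convergence at `(0, t e₀)` along the dyadic meshes:
`ρ(δ_k)² ⟨σ₀σ_{t2^{k+1}e₁}⟩ → S₂(0, t e₀)` for `t ∈ ℕ`, `t ≠ 0`. [folklore] -/
theorem tendsto_rescaled_dyadic₂
    (hlim2 : TendstoLocallyUniformlyOn (rescaledCorrelator (criticalCorr 3) ρ 2) S2 (𝓝[>] (0:ℝ))
      (NonCoincident 3 2)) {t : ℕ} (ht : t ≠ 0) :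
    Tendsto (fun k : ℕ => ρ ((2 : ℝ)⁻¹ ^ (k + 1)) ^ 2 *
        criticalTwoPoint 3 (Pi.single (0 : Fin 3) ((t : ℤ) * 2 ^ (k + 1)))) atTop
      (𝓝 (S2 ![0, EuclideanSpace.single (0 : Fin 3) (t : ℝ)])) := by
  have h := hlim2.tendsto_at (zero_unitVec_mem_nonCoincident (t := (t : ℝ)) (by exact_mod_cast ht))
  have h2 := h.comp tendsto_dyadicMesh
  refine h2.congr fun k => ?_
  simp only [Function.comp_apply]
  exact rescaledCorrelator_criticalCorr_dyadic ρ k t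

/-- `ρ(δ_k)² / ρ(δ_{k+1})² → 2^{-2Δ}` along `δ_k = 2^{-(k+1)}`, from the regular variation of the
renormalisation at the factor `1/2`. [folklore] -/
theorem tendsto_rho_sq_ratio₂ (hρ : ∀ δ ∈ Set.Ioc (0 : ℝ) 1, 0 < ρ δ) {Δ : ℝ}
    (hhalf : Tendsto (fun δ => ρ (2⁻¹ * δ) / ρ δ) (𝓝[>] 0) (𝓝 (((2:ℝ)⁻¹) ^ (-Δ)))) :
    Tendsto (fun k : ℕ => ρ ((2 : ℝ)⁻¹ ^ (k + 1)) ^ 2 / ρ ((2 : ℝ)⁻¹ ^ (k + 1 + 1)) ^ 2) atTop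
      (𝓝 ((2 : ℝ) ^ (-(2 : ℝ) * Δ))) := by
  have hρk : ∀ k : ℕ, 0 < ρ ((2 : ℝ)⁻¹ ^ (k + 1)) := fun k =>
    hρ _ ⟨dyadicMesh_pos k, dyadicMesh_le_one k⟩
  -- along the dyadic meshes: `ρ(δ_{k+1})/ρ(δ_k) → 2^{Δ}`
  have h1 : Tendsto (fun k : ℕ => ρ ((2 : ℝ)⁻¹ ^ (k + 1 + 1)) / ρ ((2 : ℝ)⁻¹ ^ (k + 1))) atTop
      (𝓝 (((2:ℝ)⁻¹) ^ (-Δ))) := by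
    refine (hhalf.comp tendsto_dyadicMesh).congr fun k => ?_
    simp only [Function.comp_apply]
    rw [pow_succ' (2 : ℝ)⁻¹ (k + 1)]
  have htwo : ((2:ℝ)⁻¹) ^ (-Δ) = (2:ℝ) ^ Δ := by
    rw [Real.inv_rpow (by norm_num), ← Real.rpow_neg (by norm_num), neg_neg]
  rw [htwo] at h1
  -- invert and square
  have h2 := (h1.inv₀ (Real.rpow_pos_of_pos two_pos Δ).ne').pow 2
  have hlim : ((2:ℝ) ^ Δ)⁻¹ ^ 2 = (2 : ℝ) ^ (-(2 : ℝ) * Δ) := by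
    rw [← Real.rpow_neg (by norm_num), ← Real.rpow_natCast, ← Real.rpow_mul (by norm_num)]
    congr 1
    push_cast
    ring
  rw [hlim] at h2
  refine h2.congr fun k => ?_
  rw [inv_div, div_pow]

/-- The logarithmic increments converge: `log ρ(δ_{k+1})² − log ρ(δ_k)² → 2Δ log 2`. [folklore] -/
theorem tendsto_log_rho_sq_sub₂ (hρ : ∀ δ ∈ Set.Ioc (0 : ℝ) 1, 0 < ρ δ) {Δ : ℝ}
    (hhalf : Tendsto (fun δ => ρ (2⁻¹ * δ) / ρ δ) (𝓝[>] 0) (𝓝 (((2:ℝ)⁻¹) ^ (-Δ)))) :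
    Tendsto (fun k : ℕ => Real.log (ρ ((2 : ℝ)⁻¹ ^ (k + 1 + 1)) ^ 2) -
        Real.log (ρ ((2 : ℝ)⁻¹ ^ (k + 1)) ^ 2)) atTop (𝓝 (2 * Δ * Real.log 2)) := by
  have hρk : ∀ k : ℕ, 0 < ρ ((2 : ℝ)⁻¹ ^ (k + 1)) := fun k =>
    hρ _ ⟨dyadicMesh_pos k, dyadicMesh_le_one k⟩
  have h := (tendsto_rho_sq_ratio₂ hρ hhalf).log (by positivity)
  have hlog2 : Real.log ((2 : ℝ) ^ (-(2 : ℝ) * Δ)) = -(2 * Δ * Real.log 2) := by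
    rw [Real.log_rpow (by norm_num)]; ring
  rw [hlog2] at h
  have h' := h.neg
  rw [neg_neg] at h'
  refine h'.congr fun k => ?_
  rw [Real.log_div (pow_ne_zero _ (hρk k).ne') (pow_ne_zero _ (hρk (k + 1)).ne')]
  ring

/-- `log ρ(δ_k)² / k → 2Δ log 2` (Cesàro average of the telescoping increments). [folklore] -/
theorem tendsto_log_rho_sq_div₂ (hρ : ∀ δ ∈ Set.Ioc (0 : ℝ) 1, 0 < ρ δ) {Δ : ℝ}
    (hhalf : Tendsto (fun δ => ρ (2⁻¹ * δ) / ρ δ) (𝓝[>] 0) (𝓝 (((2:ℝ)⁻¹) ^ (-Δ)))) :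
    Tendsto (fun k : ℕ => Real.log (ρ ((2 : ℝ)⁻¹ ^ (k + 1)) ^ 2) / k) atTop
      (𝓝 (2 * Δ * Real.log 2)) := by
  set u : ℕ → ℝ := fun k => Real.log (ρ ((2 : ℝ)⁻¹ ^ (k + 1)) ^ 2) with hu
  have hces := (tendsto_log_rho_sq_sub₂ hρ hhalf).cesaro
  have htel : ∀ k : ℕ, ∑ i ∈ Finset.range k, (u (i + 1) - u i) = u k - u 0 :=
    fun k => Finset.sum_range_sub u k
  have h1 : Tendsto (fun k : ℕ => (k : ℝ)⁻¹ * (u k - u 0)) atTop (𝓝 (2 * Δ * Real.log 2)) := by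
    refine hces.congr fun k => ?_
    simp only [hu] at htel ⊢
    rw [htel k]
  have h2 : Tendsto (fun k : ℕ => (k : ℝ)⁻¹ * u 0) atTop (𝓝 0) := by
    have := tendsto_inv_atTop_zero.comp (tendsto_natCast_atTop_atTop (R := ℝ))
    simpa using this.mul_const (u 0)
  have h3 := h1.add h2
  rw [add_zero] at h3
  refine h3.congr fun k => ?_
  simp only [hu]
  ring

/-- **The window `1/2 ≤ Δ ≤ 1` for a pair scaling limit of the critical `ℤ³` Ising two-point
function.** If the renormalised pair correlator converges locally uniformly off the diagonal to `S₂`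
(`ρ > 0` on `(0,1]`), `S₂(0, e₀) > 0`, and `ρ(δ/2)/ρ(δ) → 2^{Δ}`, then `1/2 ≤ Δ ≤ 1`: the two-point bounds
`c‖x‖⁻² ≤ ⟨σ₀σ_x⟩_{β_c} ≤ C‖x‖⁻¹` (`criticalTwoPoint_bounds_holds`) pin the growth `log ρ(δ_k)²/k → 2Δ log 2`
between `log 2` and `2 log 2`. [cite: DuminilCopin2019, Thm. 4.8, §4.4] -/
theorem pair_window₂ (hρ : ∀ δ ∈ Set.Ioc (0 : ℝ) 1, 0 < ρ δ)
    (hlim2 : TendstoLocallyUniformlyOn (rescaledCorrelator (criticalCorr 3) ρ 2) S2 (𝓝[>] (0:ℝ))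
      (NonCoincident 3 2))
    (hs₁ : 0 < S2 ![0, EuclideanSpace.single (0 : Fin 3) ((1 : ℕ) : ℝ)]) {Δ : ℝ}
    (hhalf : Tendsto (fun δ => ρ (2⁻¹ * δ) / ρ δ) (𝓝[>] 0) (𝓝 (((2:ℝ)⁻¹) ^ (-Δ)))) :
    1 / 2 ≤ Δ ∧ Δ ≤ 1 := by
  obtain ⟨c, C, hc, hbd⟩ := criticalTwoPoint_bounds_holds (d := 3) le_rfl
  -- notation
  set δ : ℕ → ℝ := fun k => (2 : ℝ)⁻¹ ^ (k + 1) with hδ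
  set x : ℕ → Site 3 := fun k => Pi.single (0 : Fin 3) (((1 : ℕ) : ℤ) * 2 ^ (k + 1)) with hx
  set G : ℕ → ℝ := fun k => criticalTwoPoint 3 (x k) with hG
  set r : ℕ → ℝ := fun k => ρ (δ k) ^ 2 * G k with hr
  set s₁ := S2 ![0, EuclideanSpace.single (0 : Fin 3) ((1 : ℕ) : ℝ)] with hs₁def
  have hs₁pos : 0 < s₁ := hs₁
  have hρk : ∀ k : ℕ, 0 < ρ (δ k) := fun k => hρ _ ⟨dyadicMesh_pos k, dyadicMesh_le_one k⟩
  -- the norm of `x k` is `2^{k+1}`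
  have hxne : ∀ k, x k ≠ 0 := by
    intro k h
    have := congrFun h 0
    simp [hx] at this
  have hnorm : ∀ k, (‖x k‖ : ℝ) = 2 ^ (k + 1) := by
    intro k
    rw [hx, norm_single_axis]
    push_cast
    rw [one_mul, abs_of_pos (by positivity)]
  -- the two-point bounds at `x k`: `c 4^{-(k+1)} ≤ G k ≤ C 2^{-(k+1)}`
  have hrpow2 : ∀ k : ℕ, ((2 ^ (k + 1) : ℝ)) ^ (-(((3 : ℕ) : ℝ) - 1)) = ((2 ^ (k + 1) : ℝ) ^ 2)⁻¹ := by
    intro k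
    rw [show (-(((3 : ℕ) : ℝ) - 1)) = -((2 : ℕ) : ℝ) by norm_num, Real.rpow_neg (by positivity),
      Real.rpow_natCast]
  have hrpow1 : ∀ k : ℕ, ((2 ^ (k + 1) : ℝ)) ^ (-(((3 : ℕ) : ℝ) - 2)) = ((2 ^ (k + 1) : ℝ))⁻¹ := by
    intro k
    rw [show (-(((3 : ℕ) : ℝ) - 2)) = -((1 : ℕ) : ℝ) by norm_num, Real.rpow_neg (by positivity),
      Real.rpow_natCast, pow_one]
  have hlow : ∀ k, c * ((2 ^ (k + 1) : ℝ) ^ 2)⁻¹ ≤ G k := by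
    intro k
    have h := (hbd (x k) (hxne k)).1
    rw [hnorm k, hrpow2 k] at h
    exact h
  have hupp : ∀ k, G k ≤ C * ((2 ^ (k + 1) : ℝ))⁻¹ := by
    intro k
    have h := (hbd (x k) (hxne k)).2
    rw [hnorm k, hrpow1 k] at h
    exact h
  have hGpos : ∀ k, 0 < G k := fun k =>
    lt_of_lt_of_le (mul_pos hc (by positivity)) (hlow k)
  have hCpos : 0 < C := by
    have h := (hGpos 0).trans_le (hupp 0)
    have : (0 : ℝ) < ((2 ^ (0 + 1) : ℝ))⁻¹ := by positivity
    nlinarith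
  -- `r k → s₁ > 0`, hence eventually `s₁/2 ≤ r k ≤ 2 s₁`
  have hrlim : Tendsto r atTop (𝓝 s₁) := tendsto_rescaled_dyadic₂ hlim2 (t := 1) one_ne_zero
  have hr_ev : ∀ᶠ k in atTop, s₁ / 2 ≤ r k ∧ r k ≤ 2 * s₁ := by
    have h1 : ∀ᶠ k in atTop, s₁ / 2 < r k := hrlim.eventually_const_lt (by linarith)
    have h2 : ∀ᶠ k in atTop, r k < 2 * s₁ := hrlim.eventually_lt_const (by linarith)
    filter_upwards [h1, h2] with k h1 h2 using ⟨h1.le, h2.le⟩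
  -- the main limit `log ρ(δ_k)² / k → 2Δ log 2`
  have hmain := tendsto_log_rho_sq_div₂ hρ hhalf
  have hlog2 : 0 < Real.log 2 := Real.log_pos (by norm_num)
  -- `log ρ(δ_k)² = log r k - log G k`
  have hlogeq : ∀ k, Real.log (ρ (δ k) ^ 2) = Real.log (r k) - Real.log (G k) := by
    intro k
    rw [hr]
    simp only
    rw [Real.log_mul (pow_ne_zero _ (hρk k).ne') (hGpos k).ne']
    ring
  have hpow1 : ∀ k : ℕ, Real.log (((2 ^ (k + 1) : ℝ))⁻¹) = -((k + 1 : ℝ) * Real.log 2) := by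
    intro k
    rw [Real.log_inv, Real.log_pow]; push_cast; ring
  have hpow2 : ∀ k : ℕ, Real.log (((2 ^ (k + 1) : ℝ) ^ 2)⁻¹) = -(2 * (k + 1 : ℝ) * Real.log 2) := by
    intro k
    rw [Real.log_inv, Real.log_pow, Real.log_pow]; push_cast; ring
  have hLB : ∀ᶠ k : ℕ in atTop,
      (Real.log (s₁ / 2) - Real.log C + (k + 1 : ℝ) * Real.log 2) / k ≤
        Real.log (ρ (δ k) ^ 2) / k := by
    filter_upwards [hr_ev, eventually_gt_atTop 0] with k hrk hk
    obtain ⟨hrk, -⟩ := hrk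
    have hk' : (0 : ℝ) < k := by exact_mod_cast hk
    rw [div_le_div_iff_of_pos_right hk', hlogeq k]
    have h1 : Real.log (G k) ≤ Real.log C + Real.log (((2 ^ (k + 1) : ℝ))⁻¹) := by
      rw [← Real.log_mul hCpos.ne' (by positivity)]
      exact Real.log_le_log (hGpos k) (hupp k)
    have h2 : Real.log (s₁ / 2) ≤ Real.log (r k) := Real.log_le_log (by positivity) hrk
    rw [hpow1 k] at h1
    linarith
  have hUB : ∀ᶠ k : ℕ in atTop,
      Real.log (ρ (δ k) ^ 2) / k ≤
        (Real.log (2 * s₁) - Real.log c + 2 * (k + 1 : ℝ) * Real.log 2) / k := by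
    filter_upwards [hr_ev, eventually_gt_atTop 0] with k hrk hk
    obtain ⟨hrk1, hrk⟩ := hrk
    have hk' : (0 : ℝ) < k := by exact_mod_cast hk
    rw [div_le_div_iff_of_pos_right hk', hlogeq k]
    have h1 : Real.log c + Real.log (((2 ^ (k + 1) : ℝ) ^ 2)⁻¹) ≤ Real.log (G k) := by
      rw [← Real.log_mul hc.ne' (by positivity)]
      exact Real.log_le_log (mul_pos hc (by positivity)) (hlow k)
    have h2 : Real.log (r k) ≤ Real.log (2 * s₁) := Real.log_le_log (by linarith) hrk
    rw [hpow2 k] at h1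
    linarith
  -- the comparison sequences converge to `log 2` and `2 log 2`
  have hinvk : Tendsto (fun k : ℕ => (k : ℝ)⁻¹) atTop (𝓝 0) :=
    tendsto_inv_atTop_zero.comp tendsto_natCast_atTop_atTop
  have hLBlim : Tendsto (fun k : ℕ => (Real.log (s₁ / 2) - Real.log C + (k + 1 : ℝ) * Real.log 2) / k)
      atTop (𝓝 (Real.log 2)) := by
    have h : ∀ k : ℕ, 0 < k → (Real.log (s₁ / 2) - Real.log C + (k + 1 : ℝ) * Real.log 2) / k =
        (Real.log (s₁ / 2) - Real.log C + Real.log 2) * (k : ℝ)⁻¹ + Real.log 2 := by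
      intro k hk
      have hk' : (k : ℝ) ≠ 0 := by exact_mod_cast hk.ne'
      field_simp
      ring
    have hl := (hinvk.const_mul (Real.log (s₁ / 2) - Real.log C + Real.log 2)).add_const (Real.log 2)
    rw [mul_zero, zero_add] at hl
    refine hl.congr' ?_
    filter_upwards [eventually_gt_atTop 0] with k hk using (h k hk).symm
  have hUBlim : Tendsto (fun k : ℕ =>
      (Real.log (2 * s₁) - Real.log c + 2 * (k + 1 : ℝ) * Real.log 2) / k) atTop (𝓝 (2 * Real.log 2)) := by
    have h : ∀ k : ℕ, 0 < k → (Real.log (2 * s₁) - Real.log c + 2 * (k + 1 : ℝ) * Real.log 2) / k =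
        (Real.log (2 * s₁) - Real.log c + 2 * Real.log 2) * (k : ℝ)⁻¹ + 2 * Real.log 2 := by
      intro k hk
      have hk' : (k : ℝ) ≠ 0 := by exact_mod_cast hk.ne'
      field_simp
      ring
    have hl := (hinvk.const_mul (Real.log (2 * s₁) - Real.log c + 2 * Real.log 2)).add_const
      (2 * Real.log 2)
    rw [mul_zero, zero_add] at hl
    refine hl.congr' ?_
    filter_upwards [eventually_gt_atTop 0] with k hk using (h k hk).symm
  have hge : Real.log 2 ≤ 2 * Δ * Real.log 2 := le_of_tendsto_of_tendsto hLBlim hmain hLB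
  have hle : 2 * Δ * Real.log 2 ≤ 2 * Real.log 2 := le_of_tendsto_of_tendsto hmain hUBlim hUB
  constructor
  · nlinarith
  · nlinarith

end Summit.CriticalPhenomena.Ising3DConformalLimit.HarmonicMomentsIsotropyTwoPoint

end
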